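import Literature.InformationTheory.Entanglement.QuantumFisherInformationSumBound
import Literature.InformationTheory.Entanglement.DickeStateWitness
import HarnessLib

/-!
# Metrology with the symmetric Dicke state: `⟨J_l⟩ = 0`, `⟨J_x²⟩ = ⟨J_y²⟩ = N(N+2)/8`, `⟨J_z²⟩ = 0`,
# `F_Q[D_N, J_x] = F_Q[D_N, J_y] = ½N(N+2)`, `F_Q[D_N, J_z] = 0` (Tóth–Apellaniz § 2.3, § 5.2; Tóth 2012)

Hodge foundations lane (`lit-hodgefound`, prover p24 gen 79; quantum-information series, file 10).  THEOREMS
ONLY: no definition, no named fact, net debt 0.  Vocabulary: the Dicke vector `dickeVec (Fin N) m = |D_N^{(m)}⟩`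
and `excCount` of `DickeStateWitness.lean` / `WStateWitness.lean`, the register spins `localPauli`,
`collectiveSpin`, `vecState`, `variance` (`SpinSqueezingCriterion.lean`), and the SLD vocabulary of the g79
series (`F_Q = 2Tr(Sρ̇)`, pure states: `QFICriterion.qfi_pure_eq_four_variance`).

## Sources (read verbatim)

* G. Tóth, I. Apellaniz, J. Phys. A **47** (2014) 424006 [TothApellaniz2014], § 2.3 (held
  `paper:arxiv-1405.4878` p0006–7): «`|D_N^{(m)}⟩ = C(N,m)^{−1/2} Σ_k 𝒫_k(|1⟩^{⊗m} ⊗ |0⟩^{⊗(N−m)})` … we are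
  interested mostly in the symmetric Dicke state for even `N` and `m = N/2` … The state (Dicke) has `⟨J_l⟩ = 0` for
  all `l = x,y,z`.  For the second moments we obtain `⟨J_x²⟩ = ⟨J_y²⟩ = N(N+2)/8`, `⟨J_z²⟩ = 0` … the state is not
  changed by dynamics of the type `exp(−iJ_zθ)`»; § 5.2 eq. (fqdicke): «for `N`-qubit symmetric Dicke states with
  `N/2` excitations … `F_Q[ϱ,J_x] = F_Q[ϱ,J_y] = ½N(N+2)`, `F_Q[ϱ,J_z] = 0` … Both GHZ states and symmetric Dicke
  states saturate the inequality for the average quantum Fisher information (avgmax)».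
* G. Tóth, PRA **85** (2012) 022322 [Toth2012MultipartiteMetrology], Observation 2: «Greenberger-Horne-Zeilinger
  states and `N`-qubit symmetric Dicke states with `N/2` excitations saturate Eq. (all)» (`Σ_l F_Q = N(N+2)`).

## What is formalized (all PROVED; general excitation number `m` where the proof allows)

§ 1 One site acting on amplitudes: **`localPauli_mulVec_apply`** (`(σ_l^{(i)}ψ)(x) = Σ_b (σ_l)_{x_i b} ψ(x[i↦b])`),
(private: excitation bookkeeping `excCount_update`).
§ 2 The Dicke vector under the spin operators: `collectiveSpin_Z_mulVec_dickeVec` (`J_z|D_N^{(m)}⟩ =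
½(N − 2m)|D_N^{(m)}⟩`), **`exchange_mulVec_dickeVec`** (`T_{ij}|D⟩ = |D⟩`: every Dicke state is swap-symmetric,
`T_{ij} = Σ_l σ_l^{(i)}σ_l^{(j)} = 2·SWAP_{ij} − 𝟙` on basis labels), `vecState_localPauli_dickeVec_eq_zero`
(`⟨σ_x^{(i)}⟩ = ⟨σ_y^{(i)}⟩ = 0`, one flip leaves the weight class), `vecState_xx_sub_yy_dickeVec`
(`⟨σ_x^{(i)}σ_x^{(j)} − σ_y^{(i)}σ_y^{(j)}⟩ = 0`, two equal flips leave the weight class).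
§ 3 Moments: **`vecState_collectiveSpin_dickeVec`** (`⟨J_x⟩ = ⟨J_y⟩ = 0`), `vecState_collectiveSpin_Z_sq_dickeVec`
(`⟨J_z²⟩ = (N−2m)²/4`), **`sum_vecState_collectiveSpin_sq_dickeVec`** (`Σ_l⟨J_l²⟩ = N(N+2)/4`, the maximal total
spin), **`vecState_collectiveSpin_X_sq_dickeVec`** / `_Y_` (`⟨J_x²⟩ = ⟨J_y²⟩ = (N(N+2) − (N−2m)²)/8`; `= N(N+2)/8`
for `m = N/2`, TA (DickePar)).
§ 4 Metrology of `|D_N⟩ = |D_N^{(N/2)}⟩`: **`qfi_dickeVec_XY`** (`F_Q[D_N, J_x] = F_Q[D_N, J_y] = ½N(N+2)` for every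
Hermitian SLD), **`qfi_dickeVec_Z`** (`= 0`), **`sum_qfi_dickeVec`** (`= N(N+2)`: saturation of Tóth's Observation 2),
`not_isSeparable_dickeVec` (`F_Q > N` for `N ≥ 2`: entangled by `QFICriterion.not_isSeparable_of_qfi_gt`).

NOT formalized: the rotational invariance `e^{−iJ_zθ}|D_N⟩ ∝ |D_N⟩` as a statement about exponentials, parity
measurements / error-propagation for the Dicke probe (§ 2.3's (Δθ)² formula).  Tree search (FAIL-DUP, 2026-09-01):
`rg -n "dickeVec" Literature` → `DickeStateWitness.lean` only (fidelity witness; no spin moments);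
`SpinSqueezing.dicke_criterion` concerns product states near Dicke states, not `|D_N⟩` itself.
-/

noncomputable section

open scoped BigOperators ComplexOrder ComplexConjugate
open Matrix Complex Finset
open Literature.Computability.QuantumComplexity
open Literature.InformationTheory.Entanglement.Tsirelson
open Literature.InformationTheory.StateDiscrimination

namespace Literature.InformationTheory.Entanglement

namespace DickeMetrology

open SpinSqueezing GHZWitness WWitness DickeWitness MerminKlyshkoGHZ UnentangledSpins QFICriterion QFISumBound

variable {N : ℕ}

/-! ## § 1 A local Pauli acting on amplitudes -/

/-- The matrix element `⟨x|σ_l^{(i)}|x[i ↦ b]⟩ = (σ_l)_{x_i b}`. [folklore] -/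
private theorem localPauli_apply_update (l : Pauli) (i : Fin N) (x : Fin N → Bool) (b : Bool) :
    localPauli l i x (Function.update x i b) = l.mat (x i) b := by
  rw [localPauli, pauliWord_apply, Finset.prod_eq_single i (fun j _ hj => by
      rw [Function.update_of_ne hj, Function.update_of_ne hj, Pauli.mat_I_apply, if_pos rfl])
    (fun h => absurd (Finset.mem_univ i) h), Function.update_self, Function.update_self]

/-- **`(σ_l^{(i)}ψ)(x) = Σ_{b} (σ_l)_{x_i b} ψ(x[i ↦ b])`**: a local Pauli only touches bit `i` (the Kronecker
structure `σ_l^{(i)} = 𝟙 ⊗ ⋯ ⊗ σ_l ⊗ ⋯ ⊗ 𝟙`). [cite: TothApellaniz2014, §2.3 («`𝒫_k(|1⟩^{⊗m} ⊗ |0⟩^{⊗(N−m)})`»)] -/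
theorem localPauli_mulVec_apply (l : Pauli) (i : Fin N) (ψ : (Fin N → Bool) → ℂ) (x : Fin N → Bool) :
    (localPauli l i *ᵥ ψ) x = ∑ b : Bool, l.mat (x i) b * ψ (Function.update x i b) := by
  rw [Matrix.mulVec, dotProduct]
  have hinj : ∀ b ∈ (Finset.univ : Finset Bool), ∀ c ∈ (Finset.univ : Finset Bool),
      Function.update x i b = Function.update x i c → b = c := fun b _ c _ h => by
    have := congrFun h i
    rwa [Function.update_self, Function.update_self] at this
  have himg : ∑ b : Bool, l.mat (x i) b * ψ (Function.update x i b) =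
      ∑ y ∈ (Finset.univ : Finset Bool).image (Function.update x i), localPauli l i x y * ψ y := by
    rw [Finset.sum_image hinj]
    exact Finset.sum_congr rfl fun b _ => by rw [localPauli_apply_update]
  rw [himg]
  symm
  refine Finset.sum_subset (Finset.subset_univ _) fun y _ hy => ?_
  have hex : ∃ j, j ≠ i ∧ x j ≠ y j := by
    by_contra h
    push Not at h
    apply hy
    refine Finset.mem_image.mpr ⟨y i, Finset.mem_univ _, funext fun j => ?_⟩
    by_cases hj : j = i
    · subst hj; rw [Function.update_self]
    · rw [Function.update_of_ne hj]; exact h j hj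
  obtain ⟨j, hji, hj⟩ := hex
  rw [localPauli, pauliWord_apply, Finset.prod_eq_zero (Finset.mem_univ j)
    (by rw [Function.update_of_ne hji, Pauli.mat_I_apply, if_neg hj]), zero_mul]

/-- **Diagonal letters act by a sign**: `(σ_z^{(i)}ψ)(x) = (−1)^{x_i} ψ(x)` (`σ_z = diag(1, −1)`).
[cite: TothApellaniz2014, §2.3] -/
theorem localPauli_Z_mulVec_apply (i : Fin N) (ψ : (Fin N → Bool) → ℂ) (x : Fin N → Bool) :
    (localPauli Pauli.Z i *ᵥ ψ) x = (if x i = true then (-1 : ℂ) else 1) * ψ x := by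
  rw [localPauli_mulVec_apply, Fintype.sum_bool, Pauli.mat_Z_apply, Pauli.mat_Z_apply]
  cases hx : x i
  · simp only [Bool.false_eq_true, if_false, if_true, zero_mul, zero_add, one_mul]
    rw [← hx, Function.update_eq_self]
  · simp only [if_true, Bool.true_eq_false, if_false, zero_mul, add_zero]
    rw [← hx, Function.update_eq_self]

/-- **Off-diagonal letters flip the bit**: for `σ_l ∈ {σ_x, σ_y}` (zero diagonal),
`(σ_l^{(i)}ψ)(x) = (σ_l)_{x_i, ¬x_i} ψ(x[i ↦ ¬x_i])`. [cite: TothApellaniz2014, §2.3] -/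
theorem localPauli_mulVec_apply_of_offdiag {l : Pauli} (hl : ∀ a : Bool, l.mat a a = 0) (i : Fin N)
    (ψ : (Fin N → Bool) → ℂ) (x : Fin N → Bool) :
    (localPauli l i *ᵥ ψ) x = l.mat (x i) (!x i) * ψ (Function.update x i (!x i)) := by
  rw [localPauli_mulVec_apply, Fintype.sum_bool]
  cases hx : x i
  · rw [hl, zero_mul, add_zero]; rfl
  · rw [hl, zero_mul, zero_add]; rfl

/-- Excitation bookkeeping under a bit update: `#(x[i ↦ b]) + [x_i] = #x + [b]`. [folklore] -/
private theorem excCount_update (x : Fin N → Bool) (i : Fin N) (b : Bool) :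
    excCount (Function.update x i b) + (if x i = true then 1 else 0) = excCount x + (if b = true then 1 else 0) := by
  rw [excCount_eq_sum, excCount_eq_sum, ← Finset.add_sum_erase _ _ (Finset.mem_univ i),
    ← Finset.add_sum_erase _ (fun j => if x j = true then 1 else 0) (Finset.mem_univ i), Function.update_self]
  have h : ∑ j ∈ Finset.univ.erase i, (if Function.update x i b j = true then 1 else 0) =
      ∑ j ∈ Finset.univ.erase i, (if x j = true then 1 else 0) :=
    Finset.sum_congr rfl fun j hj => by rw [Function.update_of_ne (Finset.ne_of_mem_erase hj)]
  rw [h]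
  ring

/-- `Σ_i (±1)_{x_i} = N − 2#x` (the eigenvalue of `2J_z` on `|x⟩`, with `σ_z = diag(1, −1)`). [folklore] -/
private theorem sum_sign_eq (x : Fin N → Bool) :
    ∑ i : Fin N, (if x i = true then (-1 : ℂ) else 1) = (N : ℂ) - 2 * (excCount x : ℂ) := by
  rw [excCount_eq_sum, Nat.cast_sum, Finset.mul_sum]
  have h : ∀ i : Fin N, (if x i = true then (-1 : ℂ) else 1) = 1 - 2 * ((if x i = true then 1 else 0 : ℕ) : ℂ) := by
    intro i; split_ifs <;> norm_num
  simp_rw [h]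
  rw [Finset.sum_sub_distrib, Finset.sum_const, Finset.card_univ, Fintype.card_fin, nsmul_eq_mul, mul_one]

/-! ## § 2 The Dicke vector under `J_z`, under the exchange operators, and under one or two flips -/

/-- **`J_z|D_N^{(m)}⟩ = ½(N − 2m)|D_N^{(m)}⟩`** (each basis label of weight `m` is a `J_z` eigenvector; in particular
`J_z|D_N⟩ = 0` for `m = N/2`: «the state is not changed by dynamics of the type `exp(−iJ_zθ)`»).
[cite: TothApellaniz2014, §2.3] -/
theorem collectiveSpin_Z_mulVec_dickeVec (m : ℕ) :
    collectiveSpin Pauli.Z N *ᵥ dickeVec (Fin N) m = (((N : ℂ) - 2 * m) / 2) • dickeVec (Fin N) m := by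
  funext x
  rw [collectiveSpin_eq_smul_sum, Matrix.smul_mulVec, Matrix.sum_mulVec, Pi.smul_apply, Finset.sum_apply,
    Pi.smul_apply, smul_eq_mul, smul_eq_mul]
  simp_rw [localPauli_Z_mulVec_apply]
  rw [← Finset.sum_mul, sum_sign_eq, dickeVec_apply]
  split_ifs with hm
  · rw [hm]; ring
  · ring

/-- `σ_x` and `σ_y` have zero diagonal. [folklore] -/
private theorem matX_diag (a : Bool) : Pauli.X.mat a a = 0 := by rw [Pauli.mat_X_apply, if_pos rfl]

/-- `σ_y` has zero diagonal. [folklore] -/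
private theorem matY_diag (a : Bool) : Pauli.Y.mat a a = 0 := by rw [Pauli.mat_Y_apply, if_pos rfl]

/-- `(σ_x)_{a,¬a} = 1`. [folklore] -/
private theorem matX_flip (a : Bool) : Pauli.X.mat a (!a) = 1 := by cases a <;> simp

/-- `(σ_x)_{¬a,a} = 1`. [folklore] -/
private theorem matX_flip' (a : Bool) : Pauli.X.mat (!a) a = 1 := by cases a <;> simp

/-- `(σ_y)_{a,¬a}² = −1` (`(±i)² = −1`). [folklore] -/
private theorem matY_flip_sq (a : Bool) : Pauli.Y.mat a (!a) * Pauli.Y.mat a (!a) = -1 := by cases a <;> simp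

/-- `(σ_y)_{a,¬a}(σ_y)_{¬a,a} = 1` (`i·(−i) = 1`). [folklore] -/
private theorem matY_flip_swap (a : Bool) : Pauli.Y.mat a (!a) * Pauli.Y.mat (!a) a = 1 := by cases a <;> simp

/-- `(−1)^{a}(−1)^{a} = 1`. [folklore] -/
private theorem sign_sq (a : Bool) :
    (if a = true then (-1 : ℂ) else 1) * (if a = true then (-1 : ℂ) else 1) = 1 := by cases a <;> simp

/-- `(−1)^{a}(−1)^{¬a} = −1`. [folklore] -/
private theorem sign_flip (a : Bool) :
    (if a = true then (-1 : ℂ) else 1) * (if (!a) = true then (-1 : ℂ) else 1) = -1 := by cases a <;> simp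

/-- One flip leaves the weight class: `D(x)·D(x[i ↦ ¬x_i]) = 0`. [folklore] -/
private theorem dickeVec_mul_flip (m : ℕ) (x : Fin N → Bool) (i : Fin N) :
    dickeVec (Fin N) m x * dickeVec (Fin N) m (Function.update x i (!x i)) = 0 := by
  rw [dickeVec_apply, dickeVec_apply]
  by_cases hx : excCount x = m
  · have h := excCount_update x i (!x i)
    have hne : excCount (Function.update x i (!x i)) ≠ m := by
      rcases Bool.eq_false_or_eq_true (x i) with hxi | hxi <;>
        simp only [hxi, Bool.not_false, Bool.not_true, if_true, Bool.false_eq_true, if_false, add_zero] at h ⊢ <;>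
        omega
    rw [if_neg hne, mul_zero]
  · rw [if_neg hx, zero_mul]

/-- Two flips of EQUAL bits leave the weight class: `D(x)·D(x[i ↦ ¬v][j ↦ ¬v]) = 0` when `x_i = x_j = v`, `i ≠ j`.
[folklore] -/
private theorem dickeVec_mul_flip_flip {i j : Fin N} (hij : i ≠ j) (m : ℕ) (x : Fin N → Bool) (hx : x i = x j) :
    dickeVec (Fin N) m x *
      dickeVec (Fin N) m (Function.update (Function.update x i (!x i)) j (!x j)) = 0 := by
  rw [dickeVec_apply, dickeVec_apply]
  by_cases hxm : excCount x = m
  · have h1 := excCount_update x i (!x i)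
    have h2 := excCount_update (Function.update x i (!x i)) j (!x j)
    rw [Function.update_of_ne hij.symm] at h2
    have hne : excCount (Function.update (Function.update x i (!x i)) j (!x j)) ≠ m := by
      rw [hx] at h1 h2 ⊢
      rcases Bool.eq_false_or_eq_true (x j) with hxj | hxj <;>
        simp only [hxj, Bool.not_false, Bool.not_true, if_true, Bool.false_eq_true, if_false, add_zero] at h1 h2 ⊢ <;>
        omega
    rw [if_neg hne, mul_zero]
  · rw [if_neg hxm, zero_mul]

/-- Two flips of DIFFERENT bits (a transposition of a `1` and a `0`) preserve the weight:
`D(x[i ↦ ¬x_i][j ↦ ¬x_j]) = D(x)` when `x_i ≠ x_j`. [folklore] -/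
private theorem dickeVec_flip_flip_of_ne {i j : Fin N} (hij : i ≠ j) (m : ℕ) (x : Fin N → Bool) (hx : x i ≠ x j) :
    dickeVec (Fin N) m (Function.update (Function.update x i (!x i)) j (!x j)) = dickeVec (Fin N) m x := by
  have h1 := excCount_update x i (!x i)
  have h2 := excCount_update (Function.update x i (!x i)) j (!x j)
  rw [Function.update_of_ne hij.symm] at h2
  have heq : excCount (Function.update (Function.update x i (!x i)) j (!x j)) = excCount x := by
    rcases Bool.eq_false_or_eq_true (x i) with hxi | hxi <;> rcases Bool.eq_false_or_eq_true (x j) with hxj | hxj <;>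
      simp only [hxi, hxj, Bool.not_false, Bool.not_true, if_true, Bool.false_eq_true, if_false, add_zero, ne_eq,
        not_true_eq_false, not_false_eq_true] at h1 h2 hx ⊢ <;> omega
  rw [dickeVec_apply, dickeVec_apply, heq]

/-- **`⟨D|σ_l^{(i)}|D⟩ = 0` for `l ∈ {x, y}`** (one flip changes the excitation number): hence `⟨J_x⟩ = ⟨J_y⟩ = 0`.
[cite: TothApellaniz2014, §2.3 («The state (Dicke) has `⟨J_l⟩ = 0` for all `l = x,y,z`»)] -/
theorem dickeVec_dotProduct_localPauli_mulVec {l : Pauli} (hl : l = Pauli.X ∨ l = Pauli.Y) (i : Fin N) (m : ℕ) :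
    star (dickeVec (Fin N) m) ⬝ᵥ (localPauli l i *ᵥ dickeVec (Fin N) m) = 0 := by
  have hdiag : ∀ a : Bool, l.mat a a = 0 := by rcases hl with rfl | rfl; exacts [matX_diag, matY_diag]
  rw [star_dickeVec, dotProduct]
  refine Finset.sum_eq_zero fun x _ => ?_
  rw [localPauli_mulVec_apply_of_offdiag hdiag, mul_left_comm, dickeVec_mul_flip, mul_zero]

/-- **`⟨D|σ_x^{(i)}σ_x^{(j)} − σ_y^{(i)}σ_y^{(j)}|D⟩ = 0`** (`= 2⟨σ₊^{(i)}σ₊^{(j)} + σ₋^{(i)}σ₋^{(j)}⟩`: two raising or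
two lowering operators change the excitation number by `2`); hence `⟨J_x²⟩ = ⟨J_y²⟩`. [cite: TothApellaniz2014,
§2.3 eq. (DickePar) («`⟨J_x²⟩ = ⟨J_y²⟩`»)] -/
theorem dickeVec_dotProduct_xx_sub_yy (i j : Fin N) (m : ℕ) :
    star (dickeVec (Fin N) m) ⬝ᵥ ((localPauli Pauli.X i * localPauli Pauli.X j -
      localPauli Pauli.Y i * localPauli Pauli.Y j) *ᵥ dickeVec (Fin N) m) = 0 := by
  by_cases hij : i = j
  · subst hij
    have hX : localPauli Pauli.X i * localPauli Pauli.X i = 1 := pauliWord_mul_self _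
    have hY : localPauli Pauli.Y i * localPauli Pauli.Y i = 1 := pauliWord_mul_self _
    rw [hX, hY, sub_self, Matrix.zero_mulVec, dotProduct_zero]
  rw [star_dickeVec, dotProduct]
  refine Finset.sum_eq_zero fun x _ => ?_
  rw [Matrix.sub_mulVec, Pi.sub_apply, ← Matrix.mulVec_mulVec, ← Matrix.mulVec_mulVec,
    localPauli_mulVec_apply_of_offdiag matX_diag, localPauli_mulVec_apply_of_offdiag matX_diag,
    localPauli_mulVec_apply_of_offdiag matY_diag, localPauli_mulVec_apply_of_offdiag matY_diag,
    Function.update_of_ne (Ne.symm hij)]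
  by_cases hx : x i = x j
  · -- equal bits: the two flips change the weight by two
    have h0 := dickeVec_mul_flip_flip hij m x hx
    rw [hx] at h0 ⊢
    have e : ∀ c₁ c₂ c₃ c₄ : ℂ, dickeVec (Fin N) m x * (c₁ * (c₂ * dickeVec (Fin N) m
        (Function.update (Function.update x i (!x j)) j (!x j))) - c₃ * (c₄ * dickeVec (Fin N) m
        (Function.update (Function.update x i (!x j)) j (!x j)))) =
        (c₁ * c₂ - c₃ * c₄) * (dickeVec (Fin N) m x * dickeVec (Fin N) m
          (Function.update (Function.update x i (!x j)) j (!x j))) := fun _ _ _ _ => by ring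
    rw [e, h0, mul_zero]
  · -- different bits: the `σ_y` phases are `i·(−i) = 1`, the two terms cancel
    have hphase : Pauli.X.mat (x i) (!x i) * Pauli.X.mat (x j) (!x j) -
        Pauli.Y.mat (x i) (!x i) * Pauli.Y.mat (x j) (!x j) = 0 := by
      cases hxi : x i <;> cases hxj : x j <;> simp_all
    have e : ∀ (c₁ c₂ c₃ c₄ : ℂ) (d : ℂ), dickeVec (Fin N) m x * (c₁ * (c₂ * d) - c₃ * (c₄ * d)) =
        (c₁ * c₂ - c₃ * c₄) * (dickeVec (Fin N) m x * d) := fun _ _ _ _ _ => by ring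
    rw [e, hphase, zero_mul]

/-- **Every Dicke state is swap-symmetric: `T_{ij}|D_N^{(m)}⟩ = |D_N^{(m)}⟩`** for `i ≠ j`, where
`T_{ij} = Σ_l σ_l^{(i)}σ_l^{(j)} = 2·SWAP_{ij} − 𝟙` (on a basis label: `T|…a…b…⟩ = 2|…b…a…⟩ − |…a…b…⟩`).
[cite: TothApellaniz2014, §2.3 («the summation is over all the different permutations»)] -/
theorem exchange_mulVec_dickeVec {i j : Fin N} (hij : i ≠ j) (m : ℕ) :
    (localPauli Pauli.X i * localPauli Pauli.X j + localPauli Pauli.Y i * localPauli Pauli.Y j +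
        localPauli Pauli.Z i * localPauli Pauli.Z j) *ᵥ dickeVec (Fin N) m = dickeVec (Fin N) m := by
  funext x
  rw [Matrix.add_mulVec, Matrix.add_mulVec, Pi.add_apply, Pi.add_apply, ← Matrix.mulVec_mulVec,
    ← Matrix.mulVec_mulVec, ← Matrix.mulVec_mulVec, localPauli_mulVec_apply_of_offdiag matX_diag,
    localPauli_mulVec_apply_of_offdiag matX_diag, localPauli_mulVec_apply_of_offdiag matY_diag,
    localPauli_mulVec_apply_of_offdiag matY_diag, localPauli_Z_mulVec_apply, localPauli_Z_mulVec_apply,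
    Function.update_of_ne (Ne.symm hij)]
  by_cases hx : x i = x j
  · -- equal bits: `XX + YY` vanishes (phases `1 + i² = 0`), `ZZ = +1`
    rw [hx, ← mul_assoc, ← mul_assoc, ← mul_assoc, matX_flip, matY_flip_sq, sign_sq]
    ring
  · -- different bits: `XX + YY = 2·(swap)`, `ZZ = −1`, and the swapped label has the same weight
    rw [dickeVec_flip_flip_of_ne hij m x hx]
    have hj : x j = !x i := by
      rcases Bool.eq_false_or_eq_true (x i) with h | h <;> rcases Bool.eq_false_or_eq_true (x j) with h' | h' <;>
        simp_all
    rw [hj, Bool.not_not, ← mul_assoc, ← mul_assoc, ← mul_assoc, matX_flip, matX_flip', matY_flip_swap, sign_flip]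
    ring

/-! ## § 3 The first and second moments of the collective spin in `|D_N^{(m)}⟩` -/

/-- **`⟨J_x⟩ = ⟨J_y⟩ = 0`** in every Dicke state. [cite: TothApellaniz2014, §2.3] -/
theorem vecState_collectiveSpin_dickeVec {l : Pauli} (hl : l = Pauli.X ∨ l = Pauli.Y) (m : ℕ) :
    vecState (dickeVec (Fin N) m) (collectiveSpin l N) = 0 := by
  rw [vecState_apply, collectiveSpin_eq_smul_sum, Matrix.smul_mulVec, Matrix.sum_mulVec, dotProduct_smul,
    dotProduct_sum]
  simp_rw [dickeVec_dotProduct_localPauli_mulVec hl]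
  simp

/-- `⟨J_z⟩ = ½(N − 2m)` (so `0` for `m = N/2`). [cite: TothApellaniz2014, §2.3] -/
theorem vecState_collectiveSpin_Z_dickeVec {m : ℕ} (hm : m ≤ N) :
    vecState (dickeVec (Fin N) m) (collectiveSpin Pauli.Z N) = ((N : ℝ) - 2 * m) / 2 := by
  rw [vecState_apply, collectiveSpin_Z_mulVec_dickeVec, dotProduct_smul,
    dickeVec_norm (by rwa [Fintype.card_fin]), smul_eq_mul, mul_one,
    show ((N : ℂ) - 2 * (m : ℂ)) / 2 = ((((N : ℝ) - 2 * m) / 2 : ℝ) : ℂ) by push_cast; ring, Complex.ofReal_re]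

/-- **`⟨J_z²⟩ = (N − 2m)²/4`** (so `⟨J_z²⟩ = 0` for `m = N/2`: TA (DickePar)). [cite: TothApellaniz2014, §2.3 eq.
(DickePar)] -/
theorem vecState_collectiveSpin_Z_sq_dickeVec {m : ℕ} (hm : m ≤ N) :
    vecState (dickeVec (Fin N) m) (collectiveSpin Pauli.Z N * collectiveSpin Pauli.Z N) =
      (((N : ℝ) - 2 * m) / 2) ^ 2 := by
  rw [vecState_apply, ← Matrix.mulVec_mulVec, collectiveSpin_Z_mulVec_dickeVec, Matrix.mulVec_smul,
    collectiveSpin_Z_mulVec_dickeVec, smul_smul, dotProduct_smul, dickeVec_norm (by rwa [Fintype.card_fin]),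
    smul_eq_mul, mul_one,
    show ((N : ℂ) - 2 * (m : ℂ)) / 2 = ((((N : ℝ) - 2 * m) / 2 : ℝ) : ℂ) by push_cast; ring, ← Complex.ofReal_mul,
    Complex.ofReal_re, sq]

/-- **`⟨J_x²⟩ + ⟨J_y²⟩ + ⟨J_z²⟩ = N(N+2)/4`** in every Dicke state (maximal total spin `j = N/2`, by the swap
symmetry `⟨T_{ij}⟩ = 1` and `Σ_l J_l² = ¼Σ_{i,j}T_{ij}`, `QFISumBound.sum_collectiveSpin_sq_eq`). [cite:
TothApellaniz2014, §2.3 eq. (DickePar)] [cite: Toth2012MultipartiteMetrology, Observation 2 («symmetric Dicke states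
… saturate»)] -/
theorem sum_vecState_collectiveSpin_sq_dickeVec {m : ℕ} (hm : m ≤ N) :
    vecState (dickeVec (Fin N) m) (collectiveSpin Pauli.X N * collectiveSpin Pauli.X N) +
        vecState (dickeVec (Fin N) m) (collectiveSpin Pauli.Y N * collectiveSpin Pauli.Y N) +
        vecState (dickeVec (Fin N) m) (collectiveSpin Pauli.Z N * collectiveSpin Pauli.Z N) =
      (N : ℝ) * (N + 2) / 4 := by
  have hnorm : star (dickeVec (Fin N) m) ⬝ᵥ dickeVec (Fin N) m = 1 := dickeVec_norm (by rwa [Fintype.card_fin])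
  rw [← map_add, ← map_add, sum_collectiveSpin_sq_eq, vecState_apply, Matrix.smul_mulVec, dotProduct_smul,
    Matrix.sum_mulVec, dotProduct_sum]
  -- each `⟨D|Σ_j T_{ij}|D⟩ = 3 + (N − 1)`
  have hrow : ∀ i : Fin N, star (dickeVec (Fin N) m) ⬝ᵥ ((∑ j : Fin N, (localPauli Pauli.X i * localPauli Pauli.X j +
      localPauli Pauli.Y i * localPauli Pauli.Y j + localPauli Pauli.Z i * localPauli Pauli.Z j)) *ᵥ
      dickeVec (Fin N) m) = (N : ℂ) + 2 := by
    intro i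
    rw [Matrix.sum_mulVec, dotProduct_sum, ← Finset.add_sum_erase _ _ (Finset.mem_univ i)]
    have hsq : ∀ l : Pauli, localPauli l i * localPauli l i = 1 := fun l => pauliWord_mul_self _
    rw [hsq, hsq, hsq, Matrix.add_mulVec, Matrix.add_mulVec, Matrix.one_mulVec, dotProduct_add, dotProduct_add,
      hnorm, Finset.sum_congr rfl fun j hj => by
        rw [exchange_mulVec_dickeVec (Finset.ne_of_mem_erase hj).symm, hnorm],
      Finset.sum_const, Finset.card_erase_of_mem (Finset.mem_univ i), Finset.card_univ, Fintype.card_fin,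
      nsmul_eq_mul, mul_one, Nat.cast_sub (Nat.one_le_iff_ne_zero.mpr (Fin.pos i).ne' |>.trans_eq rfl |> fun h => by omega)]
    push_cast; ring
  simp_rw [hrow]
  rw [Finset.sum_const, Finset.card_univ, Fintype.card_fin, nsmul_eq_mul, smul_eq_mul]
  simp only [← Complex.ofReal_natCast, ← Complex.ofReal_ofNat, ← Complex.ofReal_one, ← Complex.ofReal_div,
    ← Complex.ofReal_mul, ← Complex.ofReal_add, Complex.ofReal_re]
  ring

/-- **`⟨J_x²⟩ = ⟨J_y²⟩`** in every Dicke state. [cite: TothApellaniz2014, §2.3 eq. (DickePar)] -/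
theorem vecState_collectiveSpin_X_sq_eq_Y_sq (m : ℕ) :
    vecState (dickeVec (Fin N) m) (collectiveSpin Pauli.X N * collectiveSpin Pauli.X N) =
      vecState (dickeVec (Fin N) m) (collectiveSpin Pauli.Y N * collectiveSpin Pauli.Y N) := by
  rw [← sub_eq_zero, ← map_sub, vecState_apply, collectiveSpin_eq_smul_sum, collectiveSpin_eq_smul_sum,
    Matrix.smul_mul, Matrix.mul_smul, smul_smul, Matrix.smul_mul, Matrix.mul_smul, smul_smul, ← smul_sub,
    Finset.sum_mul_sum, Finset.sum_mul_sum, ← Finset.sum_sub_distrib, Matrix.smul_mulVec, dotProduct_smul,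
    Matrix.sum_mulVec, dotProduct_sum]
  simp_rw [← Finset.sum_sub_distrib, Matrix.sum_mulVec, dotProduct_sum, dickeVec_dotProduct_xx_sub_yy]
  simp

/-- **TA (DickePar): `⟨J_x²⟩ = (N(N+2) − (N−2m)²)/8`**, i.e. `N(N+2)/8` for the symmetric Dicke state with
`m = N/2` excitations. [cite: TothApellaniz2014, §2.3 eq. (DickePar)] -/
theorem vecState_collectiveSpin_X_sq_dickeVec {m : ℕ} (hm : m ≤ N) :
    vecState (dickeVec (Fin N) m) (collectiveSpin Pauli.X N * collectiveSpin Pauli.X N) =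
      ((N : ℝ) * (N + 2) - ((N : ℝ) - 2 * m) ^ 2) / 8 := by
  have h := sum_vecState_collectiveSpin_sq_dickeVec hm
  rw [← vecState_collectiveSpin_X_sq_eq_Y_sq, vecState_collectiveSpin_Z_sq_dickeVec hm] at h
  linarith

/-- `⟨J_y²⟩ = (N(N+2) − (N−2m)²)/8`. [cite: TothApellaniz2014, §2.3 eq. (DickePar)] -/
theorem vecState_collectiveSpin_Y_sq_dickeVec {m : ℕ} (hm : m ≤ N) :
    vecState (dickeVec (Fin N) m) (collectiveSpin Pauli.Y N * collectiveSpin Pauli.Y N) =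
      ((N : ℝ) * (N + 2) - ((N : ℝ) - 2 * m) ^ 2) / 8 := by
  rw [← vecState_collectiveSpin_X_sq_eq_Y_sq, vecState_collectiveSpin_X_sq_dickeVec hm]

/-! ## § 4 The quantum Fisher information of `|D_N⟩ = |D_{2n}^{(n)}⟩` -/

/-- **TA (fqdicke): `F_Q[D_N, J_x] = F_Q[D_N, J_y] = ½N(N+2)`** for the symmetric Dicke state with `N/2`
excitations (`N = 2n`) and every Hermitian SLD of `|D_N⟩⟨D_N|` along `J_l`, `l ∈ {x, y}` (pure state:
`F_Q = 4(ΔJ_l)² = 4⟨J_l²⟩`). [cite: TothApellaniz2014, §5.2 eq. (fqdicke)] -/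
theorem qfi_dickeVec_XY {n : ℕ} (hN : N = 2 * n) {l : Pauli} (hl : l = Pauli.X ∨ l = Pauli.Y)
    {S : Matrix (Fin N → Bool) (Fin N → Bool) ℂ} (hS : S.IsHermitian)
    (hSP : S * vecMulVec (dickeVec (Fin N) n) (star (dickeVec (Fin N) n)) +
        vecMulVec (dickeVec (Fin N) n) (star (dickeVec (Fin N) n)) * S =
      Complex.I • (vecMulVec (dickeVec (Fin N) n) (star (dickeVec (Fin N) n)) * collectiveSpin l N -
        collectiveSpin l N * vecMulVec (dickeVec (Fin N) n) (star (dickeVec (Fin N) n)))) :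
    (2 * (S * (Complex.I • (vecMulVec (dickeVec (Fin N) n) (star (dickeVec (Fin N) n)) * collectiveSpin l N -
        collectiveSpin l N * vecMulVec (dickeVec (Fin N) n) (star (dickeVec (Fin N) n))))).trace).re =
      (N : ℝ) * (N + 2) / 2 := by
  have hn : n ≤ N := by omega
  rw [qfi_pure_eq_four_variance (collectiveSpin_isHermitian l N) hS (dickeVec_norm (by rw [Fintype.card_fin]; omega))
    hSP, ← vecState_apply, ← vecState_apply, vecState_collectiveSpin_dickeVec hl]
  have hsq : vecState (dickeVec (Fin N) n) (collectiveSpin l N * collectiveSpin l N) =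
      ((N : ℝ) * (N + 2) - ((N : ℝ) - 2 * n) ^ 2) / 8 := by
    rcases hl with rfl | rfl
    exacts [vecState_collectiveSpin_X_sq_dickeVec hn, vecState_collectiveSpin_Y_sq_dickeVec hn]
  rw [hsq, hN]
  push_cast
  ring

/-- **`F_Q[D_N, J_z] = 0`** («`F_Q[ϱ,J_z] = 0`»; `J_z|D_N⟩ = 0`). [cite: TothApellaniz2014, §5.2 eq. (fqdicke)] -/
theorem qfi_dickeVec_Z {n : ℕ} (hN : N = 2 * n) {S : Matrix (Fin N → Bool) (Fin N → Bool) ℂ} (hS : S.IsHermitian)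
    (hSP : S * vecMulVec (dickeVec (Fin N) n) (star (dickeVec (Fin N) n)) +
        vecMulVec (dickeVec (Fin N) n) (star (dickeVec (Fin N) n)) * S =
      Complex.I • (vecMulVec (dickeVec (Fin N) n) (star (dickeVec (Fin N) n)) * collectiveSpin Pauli.Z N -
        collectiveSpin Pauli.Z N * vecMulVec (dickeVec (Fin N) n) (star (dickeVec (Fin N) n)))) :
    (2 * (S * (Complex.I • (vecMulVec (dickeVec (Fin N) n) (star (dickeVec (Fin N) n)) * collectiveSpin Pauli.Z N -
        collectiveSpin Pauli.Z N * vecMulVec (dickeVec (Fin N) n) (star (dickeVec (Fin N) n))))).trace).re = 0 := by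
  have hn : n ≤ N := by omega
  rw [qfi_pure_eq_four_variance (collectiveSpin_isHermitian Pauli.Z N) hS
    (dickeVec_norm (by rw [Fintype.card_fin]; omega)) hSP, ← vecState_apply, ← vecState_apply,
    vecState_collectiveSpin_Z_sq_dickeVec hn, vecState_collectiveSpin_Z_dickeVec hn, hN]
  push_cast
  ring

/-- **The symmetric Dicke state saturates Tóth's Observation 2**: `F_Q[D_N, J_x] + F_Q[D_N, J_y] + F_Q[D_N, J_z] =
½N(N+2) + ½N(N+2) + 0 = N(N+2)` (`N = 2n`, every triple of Hermitian SLDs). [cite: Toth2012MultipartiteMetrology,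
Observation 2 (saturation by «`N`-qubit symmetric Dicke states with `N/2` excitations»)] [cite: TothApellaniz2014,
§5.2 («Both GHZ states and symmetric Dicke states saturate … (avgmax)»)] -/
theorem sum_qfi_dickeVec {n : ℕ} (hN : N = 2 * n) {Sx Sy Sz : Matrix (Fin N → Bool) (Fin N → Bool) ℂ}
    (hSx : Sx.IsHermitian) (hSy : Sy.IsHermitian) (hSz : Sz.IsHermitian)
    (hx : Sx * vecMulVec (dickeVec (Fin N) n) (star (dickeVec (Fin N) n)) +
        vecMulVec (dickeVec (Fin N) n) (star (dickeVec (Fin N) n)) * Sx =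
      Complex.I • (vecMulVec (dickeVec (Fin N) n) (star (dickeVec (Fin N) n)) * collectiveSpin Pauli.X N -
        collectiveSpin Pauli.X N * vecMulVec (dickeVec (Fin N) n) (star (dickeVec (Fin N) n))))
    (hy : Sy * vecMulVec (dickeVec (Fin N) n) (star (dickeVec (Fin N) n)) +
        vecMulVec (dickeVec (Fin N) n) (star (dickeVec (Fin N) n)) * Sy =
      Complex.I • (vecMulVec (dickeVec (Fin N) n) (star (dickeVec (Fin N) n)) * collectiveSpin Pauli.Y N -
        collectiveSpin Pauli.Y N * vecMulVec (dickeVec (Fin N) n) (star (dickeVec (Fin N) n))))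
    (hz : Sz * vecMulVec (dickeVec (Fin N) n) (star (dickeVec (Fin N) n)) +
        vecMulVec (dickeVec (Fin N) n) (star (dickeVec (Fin N) n)) * Sz =
      Complex.I • (vecMulVec (dickeVec (Fin N) n) (star (dickeVec (Fin N) n)) * collectiveSpin Pauli.Z N -
        collectiveSpin Pauli.Z N * vecMulVec (dickeVec (Fin N) n) (star (dickeVec (Fin N) n)))) :
    (2 * (Sx * (Complex.I • (vecMulVec (dickeVec (Fin N) n) (star (dickeVec (Fin N) n)) * collectiveSpin Pauli.X N -
        collectiveSpin Pauli.X N * vecMulVec (dickeVec (Fin N) n) (star (dickeVec (Fin N) n))))).trace).re +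
      (2 * (Sy * (Complex.I • (vecMulVec (dickeVec (Fin N) n) (star (dickeVec (Fin N) n)) * collectiveSpin Pauli.Y N -
        collectiveSpin Pauli.Y N * vecMulVec (dickeVec (Fin N) n) (star (dickeVec (Fin N) n))))).trace).re +
      (2 * (Sz * (Complex.I • (vecMulVec (dickeVec (Fin N) n) (star (dickeVec (Fin N) n)) * collectiveSpin Pauli.Z N -
        collectiveSpin Pauli.Z N * vecMulVec (dickeVec (Fin N) n) (star (dickeVec (Fin N) n))))).trace).re =
      (N : ℝ) * (N + 2) := by
  rw [qfi_dickeVec_XY hN (Or.inl rfl) hSx hx, qfi_dickeVec_XY hN (Or.inr rfl) hSy hy, qfi_dickeVec_Z hN hSz hz]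
  ring

/-- **The symmetric Dicke state is entangled by the QFI criterion** (`N = 2n ≥ 2`): `F_Q[D_N, J_x] = ½N(N+2) > N`, so
`|D_N⟩⟨D_N|` is not fully separable (`QFICriterion.not_isSeparable_of_qfi_gt`; «All states violating [`F_Q ≤ N`] are
entangled»). [cite: TothApellaniz2014, §5.2 eqs. (F2eb), (fqdicke)] -/
theorem not_isSeparable_dickeVec {n : ℕ} (hN : N = 2 * n) (hn : 1 ≤ n) {S : Matrix (Fin N → Bool) (Fin N → Bool) ℂ}
    (hS : S.IsHermitian)
    (hSP : S * vecMulVec (dickeVec (Fin N) n) (star (dickeVec (Fin N) n)) +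
        vecMulVec (dickeVec (Fin N) n) (star (dickeVec (Fin N) n)) * S =
      Complex.I • (vecMulVec (dickeVec (Fin N) n) (star (dickeVec (Fin N) n)) * collectiveSpin Pauli.X N -
        collectiveSpin Pauli.X N * vecMulVec (dickeVec (Fin N) n) (star (dickeVec (Fin N) n)))) :
    ¬ IsSeparable (vecMulVec (dickeVec (Fin N) n) (star (dickeVec (Fin N) n))) := by
  refine not_isSeparable_of_qfi_gt Pauli.X hS hSP ?_
  rw [qfi_dickeVec_XY hN (Or.inl rfl) hS hSP]
  have h2 : (2 : ℝ) ≤ N := by exact_mod_cast (show 2 ≤ N by omega)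
  nlinarith

end DickeMetrology

end Literature.InformationTheory.Entanglement
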